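/-
COR-CM (cells pub-hodgecm / pub-hodgecm2, stage 2 of the Hodge ladder) — TRANSPOSITION SURGE, item (vi) sub-binder S2, TEAM hComp row U5
(support): the PIECES of Deligne's canonical-model system of the tree's hermitian 3-space `V` (htheta-x1's `RecordSystem.pieces`,
`Literature/AlgebraicGeometry/ShimuraVarieties/UnitaryShimuraCanonicalModel.lean` v5) packaged in the CONSUMER currency of pin-1's engine
`Model.hUnif_of_slotIso_of_pieces` (`HComp/HUnifEngine.lean`): finite index, pieces, cofan colimit, ball data, and the natural levels named
as `Level V` by hcomp-level's `HComp.Λ`.  Seat prover-pub-hodgecm2-pin-1-g2-0 (pin-1 gen 2, owner of record of binder `hComp`).  THEOREMS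
ONLY; nothing asserted; nothing in the tree edited.  FRAMING: HC_CM is NOT proved.
-/
import Literature.AlgebraicGeometry.ShimuraVarieties.UnitaryShimuraCanonicalModel
import Summits.HodgeConjecture.CorCM.B01.Transposition.HComp.Levels
import HarnessLib

/-!
# TEAM hComp, U5 support: the record's pieces at `(F, V.Hm, ι₁)` with levels in `Level V`

For a canonical-model system `S : RecordSystem F V.Hm ι₁ T hT (HComp.K3 V)` below Liu's threshold `K_f(3)` and every sufficiently small
level `K ≤ K_f(3)`, the field `S.pieces K` ([Deligne 1979, 2.1.2] «`M_ℂ` is the disjoint sum, indexed by `G(ℚ)\G(𝔸^f)/K`, of the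
`Γ_g\X⁺`», read on ball quotients of the tree's kind on the TAUTOLOGICAL ball of `V^{ι₁}`) is re-packaged as: a FINITE index
(`Deligne1979.finite_index_of_posDef_of_ne`, Godement compactness through `V.posDef_of_ne`, needs `4 ≤ [F:ℚ]`), pieces `X c`, a colimit
cofan `X c ⟶ M_K ⊗_{F,ι₁} ℂ`, ball data `B c` with `(B c).Hℂ = V.Hm^{ι₁}` and group `ι₁(Γ_c)` where `Γ c := HComp.Λ V K g_c : Level V` is
the NATURAL level `(U(V)(F⁺) ∩ g_cKg_c⁻¹, g_cKg_c⁻¹)` (hcomp-level; the group clause is `rfl` through `Λ_Γ_map`).  This is, token for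
token, the per-level «pieces» part of the hypothesis `hY` of `Model.hUnif_of_slotIso_of_pieces` at `Y := M_K ⊗_{F,ι₁} ℂ`; with b25's slot
isomorphism `Model.honestP5Of_slotIsoConj` it yields `Model.hUnif_holds` (`HComp/HUnifHolds.lean`).  HC_CM is NOT proved.
-/

noncomputable section

namespace Summit.HodgeConjecture.CorCM.Model

open CategoryTheory CategoryTheory.Limits AlgebraicGeometry NumberField
open Literature.AlgebraicGeometry.Motives
open Literature.AlgebraicGeometry.ShimuraVarieties
open Literature.AlgebraicGeometry.ShimuraVarieties.UnitaryCanonicalModel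
open Literature.NumberTheory.Automorphic
open Literature.NumberTheory.Automorphic.UnitaryGroup
open Literature.NumberTheory.Automorphic.Liu2021
open Literature.NumberTheory.Automorphic.Liu2021.AppendixC
open Literature.Geometry.ComplexHyperbolic
open Summit.HodgeConjecture.CorCM.HComp

/-- **The record's pieces at `(F, V.Hm, ι₁)`, levels named in `Level V`.**  For `S : RecordSystem F V.Hm ι₁ T hT (K3 V)` (Deligne's
canonical-model system of `Sh(Res_{F⁺/ℚ} U(V), h_{V,ῑ₁})` below `K_f(3)`, [Deligne 1979] 2.2.5 / Cor. 2.7.21), `4 ≤ [F:ℚ]`, and `K ≤ K_f(3)`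
open compact: finitely many pieces `X c` with a colimit cofan into `M_K ⊗_{F,ι₁} ℂ`, ball data `B c` with `(B c).Hℂ = V.Hm^{ι₁}` and
`τ₁(Γ_{B c}) = ι₁((Γ c).Γ)` for `Γ c := HComp.Λ V K.1 K.2 (g c) : Level V` — the field `S.pieces K` ([Deligne 1979, 2.1.2]) with
`Cset := Ξ_K` (finite: `Deligne1979.finite_index_of_posDef_of_ne`) and the natural levels `U(V)(F⁺) ∩ g_cKg_c⁻¹` read as tree levels
(`HComp.Λ`; `Λ_Γ_map` is `rfl`).  Glue, ours.  HC_CM is NOT proved. [cite: Deligne1979ShimuraVarieties, §2.1.2 and 2.2.5] -/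
theorem exists_pieces_level_of_recordSystem {F : CMField} {ι₁ : F →+* ℂ} (V : HermSpace3 F ι₁)
    {T : GL (Fin 3) ℂ} {hT : formCongr (starRingEnd ℂ) T (V.Hm.map ι₁) = BallModel.J}
    (S : RecordSystem F V.Hm ι₁ T hT (K3 V)) (h4 : 4 ≤ Module.finrank ℚ F) (K : C5.SmallLevel (K3 V)) :
    ∃ (Cset : Type) (_ : Fintype Cset) (X : Cset → SchemeOver ℂ) (ι : ∀ c, X c ⟶ (baseChangeHom ι₁).obj (S.M.obj K))
      (_ : IsColimit (Cofan.mk ((baseChangeHom ι₁).obj (S.M.obj K)) ι)) (B : ∀ c, UnitaryBallUniformisationDatum 2 (X c))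
      (Γ : Cset → Level V),
      ∀ c, (B c).Hℂ = V.Hm.map ι₁ ∧
        (B c).Γ.map (Matrix.GeneralLinearGroup.map (B c).τ₁) = (Γ c).Γ.map (Matrix.GeneralLinearGroup.map ι₁) := by
  obtain ⟨g, -, X, ι, hcol, B, hB⟩ := S.pieces K
  haveI := Deligne1979.finite_index_of_posDef_of_ne F V.Hm ι₁ (K.1.1 : Subgroup V.adelicFin) h4 V.posDef_of_ne K.1.2.1
  exact ⟨_, Fintype.ofFinite _, X, ι, hcol, B, fun q => HComp.Λ V K.1 K.2 (g q), fun q => ⟨(hB q).1, (hB q).2.1⟩⟩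

end Summit.HodgeConjecture.CorCM.Model

end
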